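import Mathlib
import Summits.Ventures.PercRepro2.Defs
import Summits.Ventures.PercRepro2.ThreeEventCertificate
import Summits.Ventures.PercRepro2.ThreeEventAntipodal
import Summits.Ventures.PercRepro2.ThreeEventAntipodalInduction

/-!
# The antipodal induction for a CLASS of quadruples, and the antipodal Harris inequality
(blind cell PercRepro2, p4 g35)

`antiCount_nonneg_of_antipodal_certificates_class`: the induction of ThreeEventAntipodalInduction for any
class `P` of quadruples (a predicate on quadruples of every finite cube of a universe) closed under the
sections at an open edge: if every quadruple of `P` on every nonempty cube has an edge with an
antipodal-pointwise certificate made of quadruples of `P`, then `Φ ≥ 0` on `P`. The admissible class is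
the case of ThreeEventAntipodalInduction; here the class `B = ∅` (two upper sets `G`, `H`, any `M`): at EVERY
edge the two cylinders `{ω | ω[e↦0] ∈ G}`, `{ω | ω[e↦1] ∈ G}` (with the same for `H`) certify, because
`χ_e(x, y) − c₀(x, y) − c₁(x, y) = (1_G(x) − 1_G(x[e↦0])) · (1_H(y) − 1_H(y[e↦0])) ≥ 0` pointwise
(`cross_sub_cylinders_nonneg`). Hence `antiCount_nonneg_of_isUpperSet`: `Φ(G, H, M, ∅) = |G ∩ H| − |{ω ∈ H :
ω̄ ∈ G}| ≥ 0` for upper sets `G`, `H` — the ANTIPODAL HARRIS (Kleitman) inequality, proved inside the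
antipodal proof system (a sanity theorem: the system is complete on the class `B = ∅`). Definitions
`cylAt` (the two cylinders); no instance, no notation.
-/

namespace Summit.Ventures.PercRepro2

namespace ThreeEvent

section ClassInduction

universe u

variable {R : Type*} [CommRing R] [LinearOrder R] [IsStrictOrderedRing R]

/-- **The antipodal induction for a class `P` of quadruples closed under sections.** -/
theorem antiCount_nonneg_of_antipodal_certificates_class
    (P : ∀ {F : Type u}, Set (Config F) → Set (Config F) → Set (Config F) → Set (Config F) → Prop)
    (hsec : ∀ {F : Type u} [DecidableEq F] (e : F) (G H M B : Set (Config F)), P G H M B →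
      P (secAt e G) (secAt e H) (secAt e M) (secAt e B))
    (hcert : ∀ (F : Type u) [Fintype F] [DecidableEq F], Nonempty F →
      ∀ (G H M B : Set (Config F)), P G H M B →
        ∃ e : F, ∃ (k : ℕ) (G₁ H₁ M₁ B₁ : Fin k → Set (Config F)) (l : Fin k → R),
          (∀ i, P (G₁ i) (H₁ i) (M₁ i) (B₁ i)) ∧ (∀ i, 0 ≤ l i) ∧
          ∀ ω : Config F, ω e = true →
            (∑ i, l i * (pairWt (G₁ i) (H₁ i) (M₁ i) (B₁ i) ω (antipodeAt e ω)
                + pairWt (G₁ i) (H₁ i) (M₁ i) (B₁ i) (antipodeAt e ω) ω))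
              ≤ (pairWt G H M B (Function.update ω e false) (antipodeAt e ω)
                  + pairWt G H M B ω (Function.update (antipodeAt e ω) e false))
                + (pairWt G H M B (Function.update (antipodeAt e ω) e false) ω
                  + pairWt G H M B (antipodeAt e ω) (Function.update ω e false))) :
    ∀ (n : ℕ) (F : Type u) [Fintype F] [DecidableEq F], Fintype.card F = n →
      ∀ (G H M B : Set (Config F)), P G H M B → (0 : R) ≤ antiCount G H M B := by
  intro n
  induction n with
  | zero =>
    intro F _ _ hF G H M B _
    haveI : IsEmpty F := Fintype.card_eq_zero_iff.mp hF
    rw [antiCount_of_isEmpty]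
  | succ n ih =>
    intro F _ _ hF G H M B hP
    haveI : Nonempty F := Fintype.card_pos_iff.mp (by omega)
    obtain ⟨e, k, G₁, H₁, M₁, B₁, l, hP₁, hl, hpt⟩ := hcert F inferInstance G H M B hP
    refine le_trans ?_ (antiCount_ge_of_antipodal_certificate e G H M B G₁ H₁ M₁ B₁ l hpt)
    refine Finset.sum_nonneg fun i _ => mul_nonneg (hl i) ?_
    rw [antiCountAt_eq_antiCount_secAt]
    exact ih {f // f ≠ e} (by rw [card_ne_eq, hF]; rfl) _ _ _ _ (hsec e _ _ _ _ (hP₁ i))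

end ClassInduction

section Cylinders

variable {E : Type*} [DecidableEq E]

/-- The cylinder of the section of `S` at `e ↦ b`: the configurations whose `e`-update to `b` lies in `S`. -/
def cylAt (e : E) (b : Bool) (S : Set (Config E)) : Set (Config E) := {ω | Function.update ω e b ∈ S}

/-- Membership in a cylinder. -/
lemma mem_cylAt (e : E) (b : Bool) (S : Set (Config E)) (ω : Config E) :
    ω ∈ cylAt e b S ↔ Function.update ω e b ∈ S := Iff.rfl

/-- Updating an edge is monotone. -/
lemma update_mono (e : E) (b : Bool) {ω ω' : Config E} (h : ω ≤ ω') :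
    Function.update ω e b ≤ Function.update ω' e b := by
  intro f
  by_cases hf : f = e
  · subst hf
    simp
  · rw [Function.update_of_ne hf, Function.update_of_ne hf]
    exact h f

/-- The cylinder of an upper set is an upper set. -/
lemma isUpperSet_cylAt (e : E) (b : Bool) {S : Set (Config E)} (hS : IsUpperSet S) :
    IsUpperSet (cylAt e b S) :=
  fun _ _ h hω => hS (update_mono e b h) hω

/-- Closing an edge lowers a configuration. -/
lemma update_false_le (e : E) (ω : Config E) : Function.update ω e false ≤ ω := by
  intro f
  by_cases hf : f = e
  · subst hf
    simp
  · rw [Function.update_of_ne hf]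

/-- Membership in a cylinder at `e ↦ true` of a configuration with `e` open. -/
lemma mem_cylAt_true_of_open (e : E) (S : Set (Config E)) {ω : Config E} (h : ω e = true) :
    ω ∈ cylAt e true S ↔ ω ∈ S := by
  rw [mem_cylAt, ← h, Function.update_eq_self]

/-- Membership in a cylinder at `e ↦ false` of a configuration with `e` closed. -/
lemma mem_cylAt_false_of_closed (e : E) (S : Set (Config E)) {ω : Config E} (h : ω e = false) :
    ω ∈ cylAt e false S ↔ ω ∈ S := by
  rw [mem_cylAt, ← h, Function.update_eq_self]

end Cylinders

section HarrisClass

variable {E : Type*} [DecidableEq E] {R : Type*} [CommRing R] [LinearOrder R] [IsStrictOrderedRing R]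

omit [DecidableEq E] [LinearOrder R] [IsStrictOrderedRing R] in
/-- The pair weight of a quadruple with `B = ∅`: `c(x, y) = 1_H(y) (1_G(y) − 1_G(x))`. -/
lemma pairWt_empty (G H M : Set (Config E)) (x y : Config E) :
    (pairWt G H M ∅ x y : R) = H.indicator 1 y * (G.indicator 1 y - G.indicator 1 x) := by
  unfold pairWt
  simp only [Set.empty_inter, Set.inter_empty, Set.indicator_empty, mul_zero, sub_zero, add_zero]
  rw [Set.inter_indicator_one, Pi.mul_apply]
  ring

omit [DecidableEq E] in
/-- Indicators of an upper set are monotone. -/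
lemma indicator_le_of_isUpperSet {S : Set (Config E)} (hS : IsUpperSet S) {ω ω' : Config E}
    (h : ω ≤ ω') : S.indicator (1 : Config E → R) ω ≤ S.indicator 1 ω' := by
  by_cases hω : ω ∈ S
  · rw [Set.indicator_of_mem hω, Set.indicator_of_mem (hS h hω)]
    exact le_rfl
  · rw [Set.indicator_of_notMem hω]
    by_cases hω' : ω' ∈ S
    · rw [Set.indicator_of_mem hω']; exact zero_le_one
    · rw [Set.indicator_of_notMem hω']

/-- **The cross pair weight dominates the two cylinders on the class `B = ∅`**:
`χ_e(x, y) − c_{cyl₀}(x, y) − c_{cyl₁}(x, y) = (1_G(x) − 1_G(x[e↦0])) (1_H(y) − 1_H(y[e↦0])) ≥ 0` for `x`, `y`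
with `e` open. -/
lemma cross_sub_cylinders_nonneg (e : E) {G H : Set (Config E)} (hG : IsUpperSet G)
    (hH : IsUpperSet H) (M : Set (Config E)) {x y : Config E} (hx : x e = true) (hy : y e = true) :
    (pairWt (cylAt e false G) (cylAt e false H) M ∅ x y : R)
        + pairWt (cylAt e true G) (cylAt e true H) M ∅ x y
      ≤ pairWt G H M ∅ (Function.update x e false) y + pairWt G H M ∅ x (Function.update y e false) := by
  have e1 : ∀ S : Set (Config E), (cylAt e false S).indicator (1 : Config E → R) x
      = S.indicator 1 (Function.update x e false) := fun S => by
    by_cases h : x ∈ cylAt e false S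
    · rw [Set.indicator_of_mem h, Set.indicator_of_mem ((mem_cylAt e false S x).1 h)]
      rfl
    · rw [Set.indicator_of_notMem h, Set.indicator_of_notMem (fun h' => h ((mem_cylAt e false S x).2 h'))]
  have e2 : ∀ S : Set (Config E), (cylAt e false S).indicator (1 : Config E → R) y
      = S.indicator 1 (Function.update y e false) := fun S => by
    by_cases h : y ∈ cylAt e false S
    · rw [Set.indicator_of_mem h, Set.indicator_of_mem ((mem_cylAt e false S y).1 h)]
      rfl
    · rw [Set.indicator_of_notMem h, Set.indicator_of_notMem (fun h' => h ((mem_cylAt e false S y).2 h'))]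
  have e3 : ∀ S : Set (Config E), (cylAt e true S).indicator (1 : Config E → R) x = S.indicator 1 x :=
    fun S => by
    by_cases h : x ∈ S
    · rw [Set.indicator_of_mem h, Set.indicator_of_mem ((mem_cylAt_true_of_open e S hx).2 h)]
    · rw [Set.indicator_of_notMem h, Set.indicator_of_notMem (fun h' => h ((mem_cylAt_true_of_open e S hx).1 h'))]
  have e4 : ∀ S : Set (Config E), (cylAt e true S).indicator (1 : Config E → R) y = S.indicator 1 y :=
    fun S => by
    by_cases h : y ∈ S
    · rw [Set.indicator_of_mem h, Set.indicator_of_mem ((mem_cylAt_true_of_open e S hy).2 h)]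
    · rw [Set.indicator_of_notMem h, Set.indicator_of_notMem (fun h' => h ((mem_cylAt_true_of_open e S hy).1 h'))]
  simp only [pairWt_empty, e1, e2, e3, e4]
  have hGx : G.indicator (1 : Config E → R) (Function.update x e false) ≤ G.indicator 1 x :=
    indicator_le_of_isUpperSet hG (update_false_le e x)
  have hHy : H.indicator (1 : Config E → R) (Function.update y e false) ≤ H.indicator 1 y :=
    indicator_le_of_isUpperSet hH (update_false_le e y)
  nlinarith [mul_nonneg (sub_nonneg.2 hGx) (sub_nonneg.2 hHy)]

end HarrisClass

section HarrisConclusion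

universe u

variable {R : Type*} [CommRing R] [LinearOrder R] [IsStrictOrderedRing R]

/-- **The antipodal Harris inequality**: for upper sets `G`, `H` of a finite cube,
`Φ(G, H, M, ∅) = Σ_ω 1_H(ω) (1_G(ω) − 1_G(ω̄)) = |G ∩ H| − |{ω ∈ H : ω̄ ∈ G}| ≥ 0` (any `M`) — proved by the
antipodal induction on the class `B = ∅`, certified at every edge by the two cylinders. -/
theorem antiCount_nonneg_of_isUpperSet (F : Type u) [Fintype F] [DecidableEq F]
    {G H : Set (Config F)} (hG : IsUpperSet G) (hH : IsUpperSet H) (M : Set (Config F)) :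
    (0 : R) ≤ antiCount G H M ∅ := by
  refine antiCount_nonneg_of_antipodal_certificates_class
    (R := R) (fun G H _ B => IsUpperSet G ∧ IsUpperSet H ∧ B = ∅) ?_ ?_ (Fintype.card F) F rfl G H M ∅
    ⟨hG, hH, rfl⟩
  · intro F' _ e G' H' M' B' h
    refine ⟨isUpperSet_secAt e h.1, isUpperSet_secAt e h.2.1, ?_⟩
    rw [h.2.2]
    rfl
  · intro F' _ _ hne G' H' M' B' h
    obtain ⟨e⟩ := hne
    refine ⟨e, 2, ![cylAt e false G', cylAt e true G'], ![cylAt e false H', cylAt e true H'],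
      ![M', M'], ![∅, ∅], ![1, 1], ?_, ?_, ?_⟩
    · intro i
      fin_cases i
      · exact ⟨isUpperSet_cylAt e false h.1, isUpperSet_cylAt e false h.2.1, rfl⟩
      · exact ⟨isUpperSet_cylAt e true h.1, isUpperSet_cylAt e true h.2.1, rfl⟩
    · intro i
      fin_cases i <;> simp
    · intro ω hω
      rw [h.2.2]
      simp only [Fin.sum_univ_two, Matrix.cons_val_zero, Matrix.cons_val_one, one_mul]
      have h1 := cross_sub_cylinders_nonneg (R := R) e h.1 h.2.1 M' hω (antipodeAt_apply_self e ω)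
      have h2 := cross_sub_cylinders_nonneg (R := R) e h.1 h.2.1 M' (antipodeAt_apply_self e ω) hω
      linarith

end HarrisConclusion

end ThreeEvent

end Summit.Ventures.PercRepro2
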